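import Mathlib
import HarnessLib

/-!
# S2 chart objects: the straightened chart ring `M_I = k[s, c_K, e_J][h_M⁻¹]` of the conductor-𝟙 core
(crux stmt-ResolutionOfSingularities-15640 `WildQuotients.WildQuotientResolution`, line `Sketch`;
chain w45c post-V5 programme S2, design `L/res-L1-w45c-lead-1/S2-DESIGN.md` v1.1 §7 (7.1)/(7.5),
res-L1-w45c-plan-1 RULING 2026-08-27T17:07:17Z (R1) «letters of record». [OURS · L1 W4.5c] —
replaces the role of no printed item; NOT a statement of the manuscript. Lead prover res-L1-w45c-lead-1.)

One chart of the frame `V = Bl_𝔪 Spec Aₙ` per boolean point: the index is a non-empty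
`I ⊆ Fin n` with base coordinate `i` (the frame takes `i = min I`). In the STRAIGHTENED coordinates
`s = uᵢ`, `c_l = (1 − t_l)/t_l` (`l ∈ I`, `l ≠ i`), `e_l = t_l/(1 − t_l)` (`l ∉ I`), `t_l = u_l/uᵢ`, the
chart `O_I = V[uᵢ] ∩ D(∏_{l ∈ I∖i} t_l) ∩ D(∏_{l ∉ I} (1 − t_l))` has coordinate ring
`k[s, c, e][h_M⁻¹]` and the lifted conductor-𝟙 action is DIAGONAL-MÖBIUS:
`σ̃ s·(1+s) = s`, `σ̃ c_l·(1+s) = c_l`, `σ̃ e_l = e_l·(1+s)`. This DEFINITIONS file fixes: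

* `ConductorOne.chartWeight p n I : Fin n → ZMod p` — `1` on `I`, `−1` off `I` (the weight vector of
  the local `μ_p`-model `PthCone.cone k n p (chartWeight p n I)`, design (7.2));
* `ConductorOne.chartDen k p n i I` — `h_M = (1 − Xᵢ^{p−1}) · ∏_{l ∈ I∖i} (1 + X_l)((1 + X_l)^{p−1} − Xᵢ^{p−1})
  · ∏_{l ∉ I} (1 + X_l)((1 + X_l)^{p−1} − (Xᵢ X_l)^{p−1})` (the unit `u`, the inverted `t_l`/`1 − t_l`,
  and the `Dₙ`-factors `1 − u_l^{p−1}` up to units);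
* `ConductorOne.ChartRing k p n i I = Localization.Away (chartDen k p n i I)` (an `abbrev`) and the
  coordinates `ConductorOne.chartX k p n i I l`;
* `ConductorOne.IsChartAction k p n i I σ` — the three laws for a ring endomorphism `σ` of the chart
  ring (stated for every `l ∈ I`, the case `l = i` being the `s`-law again).

No theorems live here (definition lane): the law calculus is `…ConductorOneChartAlgebra(SCE).lean`
(res-L1-w45c-stub-3), the identification with `Γ(O_I)` is the frame file (res-D-pv-033), the
invariant presentation (CLAIM P) is `…ConductorOnePresentation.lean` (lead-1).
-/

-- single-problem summit: the doubled namespace component `ResolutionOfSingularities` is forced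
set_option linter.dupNamespace false

noncomputable section

open MvPolynomial

namespace Summit.ResolutionOfSingularities.ResolutionOfSingularities.Theorems.WildQuotientResolution.ConductorOne

/-- The weight vector of the chart `I`: `1` on `I`, `−1` off `I` (in `ZMod p`). [OURS · L1 W4.5c] -/
def chartWeight (p n : ℕ) (I : Finset (Fin n)) : Fin n → ZMod p :=
  fun l => if l ∈ I then 1 else -1

/-- The inverted element `h_M` of the straightened chart `O_I` with base coordinate `i`:
`(1 − Xᵢ^{p−1}) · ∏_{l ∈ I∖i} (1 + X_l)((1 + X_l)^{p−1} − Xᵢ^{p−1}) · ∏_{l ∉ I} (1 + X_l)((1 + X_l)^{p−1} − (Xᵢ X_l)^{p−1})`.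
[OURS · L1 W4.5c] -/
def chartDen (k : Type) [Field k] (p n : ℕ) (i : Fin n) (I : Finset (Fin n)) :
    MvPolynomial (Fin n) k :=
  (1 - X i ^ (p - 1)) *
    ((∏ l ∈ I.erase i, ((1 + X l) * ((1 + X l) ^ (p - 1) - X i ^ (p - 1)))) *
      ∏ l ∈ Finset.univ \ I, ((1 + X l) * ((1 + X l) ^ (p - 1) - (X i * X l) ^ (p - 1))))

/-- The straightened chart ring `M_I = k[s, c, e][h_M⁻¹]`. [OURS · L1 W4.5c] -/
abbrev ChartRing (k : Type) [Field k] (p n : ℕ) (i : Fin n) (I : Finset (Fin n)) : Type :=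
  Localization.Away (chartDen k p n i I)

/-- The coordinate `X_l` in the chart ring (`l = i`: `s`; `l ∈ I∖i`: `c_l`; `l ∉ I`: `e_l`).
[OURS · L1 W4.5c] -/
abbrev chartX (k : Type) [Field k] (p n : ℕ) (i : Fin n) (I : Finset (Fin n)) (l : Fin n) :
    ChartRing k p n i I :=
  algebraMap (MvPolynomial (Fin n) k) (ChartRing k p n i I) (X l)

/-- **The diagonal-Möbius laws** of the lifted conductor-𝟙 action on the chart ring with base
coordinate `i`: `σ s·(1+s) = s` (`s = Xᵢ`), `σ c_l·(1+s) = c_l` for `l ∈ I`, `σ e_l = e_l·(1+s)`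
for `l ∉ I`. [OURS · L1 W4.5c] -/
def IsChartAction (k : Type) [Field k] (p n : ℕ) (i : Fin n) (I : Finset (Fin n))
    (σ : ChartRing k p n i I →+* ChartRing k p n i I) : Prop :=
  σ (chartX k p n i I i) * (1 + chartX k p n i I i) = chartX k p n i I i ∧
    (∀ l ∈ I, σ (chartX k p n i I l) * (1 + chartX k p n i I i) = chartX k p n i I l) ∧
    (∀ l ∉ I, σ (chartX k p n i I l) = chartX k p n i I l * (1 + chartX k p n i I i))

end Summit.ResolutionOfSingularities.ResolutionOfSingularities.Theorems.WildQuotientResolution.ConductorOne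

end
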